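import Summits.QuantumFields.YangMills.Theorems.LuscherReductionTwistedTraceScalingBTProfileBudget
import HarnessLib

/-!
# (C5-T′) THE SCHEDULE OF THE FP TAIL PIECE: the six side conditions and `β·m_nt ≥ log⁴β/4`, `β·m_far ≥ q·log⁴β` eventually, for a slow window of ANY width `D·β^{-s}`
# (lane A of S-BASE, crux `TwistedTraceScaling` stmt-QuantumFields-20203, C4-CORE, the (OD) pen; feeds `…BODefectTailPiece.tail_sq_integral_le`)

`…BTProfileBudget.eventually_btMnt_ge_B` / `eventually_btMfar_ge_B` give the two tail exponents on schedule B with the slow window `recordDelta1 = 14β^{-s}/|Site|` on BOTH slow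
points.  In the hOD defect the OUTPUT slow point is the slow mean of a point of the support of the record weight, which `…BORecordSupport.recordChi_support` only places in the
wider window `‖q(u'_k) − 1‖ ≤ 517β^{-s}/|Site|`; so the tail piece needs the same schedule facts for a window `δ = D·β^{-s}` of arbitrary width `D ≥ 14/|Site|` (with the far
threshold `P₀ = 13δ` scaled along).  The proofs are those of `…BTProfileBudget` with `δ` generalised (every use of `δ` there is through `0 ≤ δ`, `δ → 0`, `δ ≥ 9β^{-1/2}ℓ`):
★★ `eventually_tail_schedule` — for `0 < s < 1/2`, `D ≥ 14/|Site|`, radius `r_f = min(1/40, β^{-1/2}ℓ)`, `α = β^{-1/2}ℓ²`, `R₁' = 5β^{-1/2}ℓ²`, `ε = β^{-1}`: `∃ q > 0`, eventually,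
the six side conditions `hLa, hm₁, hm₂, hP, hP0, hJ` of `…BODefectTailFP.colour_fpFibreTransfer_tail_le` hold at `(δ, α, r_f, R₁', ε, 13δ)` and
`log⁴β/4 ≤ β·btMnt L δ α r_f R₁' ε`, `q·log⁴β ≤ β·btMfar L δ α r_f ε (13δ)`.
HONEST FRAMING: bookkeeping for a stub of a child of the CONDITIONAL route R2b1; (C5)-out, the hOD assembly, (B-ST), C4-CORE OPEN; not infinite volume, not a gap, not Clay.
-/

set_option autoImplicit false

noncomputable section

open MeasureTheory Filter Topology Real
open scoped BigOperators
open Literature.MathematicalPhysics.QuantumFieldTheory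
open Literature.MathematicalPhysics.QuantumLattice

namespace Summit.QuantumFields.YangMills.Theorems.FemtoTransferGap.TwoLattice.ConstTube

open Summit.QuantumFields.YangMills.Theorems.FemtoTransferGap
open Summit.QuantumFields.YangMills.Theorems.FemtoTransferGap.TwoLattice
open Summit.QuantumFields.YangMills.Theorems.FemtoTransferGap.TwoLattice.Cov

variable {L : ℕ} [NeZero L]

set_option maxHeartbeats 800000 in
-- one long eventual computation with ~40 intermediate real inequalities; the final `linarith` calls exceed the default budget.
/-- ★★ **THE TAIL SCHEDULE FOR A SLOW WINDOW OF ANY WIDTH** (see the module docstring). [folklore] -/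
theorem eventually_tail_schedule {s : ℝ} (hs : 0 < s) (hs2 : s < 1 / 2) {Dδ : ℝ} (hD : 14 / Fintype.card (Site 3 L) ≤ Dδ) :
    ∃ q : ℝ, 0 < q ∧ ∀ᶠ β : ℝ in atTop,
      18 * L * (Real.sqrt 2 * (min (1 / 40) (powScale (1 / 2) β * btLog β)) + Dδ * powScale s β) ≤ 1 / 2 ∧
      0 ≤ (5 * (powScale (1 / 2) β * btLog β ^ 2)) / 2 - 2 * (Real.sqrt 2 * (min (1 / 40) (powScale (1 / 2) β * btLog β)) + Dδ * powScale s β) * (powScale 1 β) - (2 * Real.sqrt 2 * (min (1 / 40) (powScale (1 / 2) β * btLog β)) + powScale (1 / 2) β * btLog β ^ 2) ∧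
      0 ≤ 1 / (3 * L) - 4 * (Real.sqrt 2 * (min (1 / 40) (powScale (1 / 2) β * btLog β)) + Dδ * powScale s β) - (2 * Real.sqrt 2 * (min (1 / 40) (powScale (1 / 2) β * btLog β)) + powScale (1 / 2) β * btLog β ^ 2) ∧
      3 * L * (13 * (Dδ * powScale s β)) < 1 ∧
      0 ≤ 13 * (Dδ * powScale s β) - 4 * (Real.sqrt 2 * (min (1 / 40) (powScale (1 / 2) β * btLog β)) + Dδ * powScale s β) - (2 * Real.sqrt 2 * (min (1 / 40) (powScale (1 / 2) β * btLog β)) + 2 * (Dδ * powScale s β)) ∧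
      2 * (powScale 1 β) * Fintype.card (Site 3 L) * (Dδ * powScale s β) + 2 * (min (1 / 40) (powScale (1 / 2) β * btLog β)) ^ 2 +
          2 * Real.sqrt 2 * Fintype.card (Site 3 L) * (9 * L * (13 * (Dδ * powScale s β)) + (powScale 1 β)) * (min (1 / 40) (powScale (1 / 2) β * btLog β)) ≤
        Fintype.card (Site 3 L) * (1 - 3 * L * (13 * (Dδ * powScale s β))) * (powScale (1 / 2) β * btLog β ^ 2) ∧
      Real.log β ^ 4 / 4 ≤ β * btMnt L (Dδ * powScale s β) (powScale (1 / 2) β * btLog β ^ 2) (min (1 / 40) (powScale (1 / 2) β * btLog β)) (5 * (powScale (1 / 2) β * btLog β ^ 2)) (powScale 1 β) ∧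
      q * Real.log β ^ 4 ≤ β * btMfar L (Dδ * powScale s β) (powScale (1 / 2) β * btLog β ^ 2) (min (1 / 40) (powScale (1 / 2) β * btLog β)) (powScale 1 β) (13 * (Dδ * powScale s β)) := by
  have hL1 : (1 : ℝ) ≤ L := by exact_mod_cast NeZero.one_le
  have hL0 : (0 : ℝ) < L := by linarith
  have hN : (0 : ℝ) < Fintype.card (Site 3 L) := by exact_mod_cast Fintype.card_pos
  have hN1 : (1 : ℝ) ≤ Fintype.card (Site 3 L) := by exact_mod_cast Fintype.card_pos
  have hE : (0 : ℝ) < Fintype.card (Edge 3 L) := by exact_mod_cast Fintype.card_pos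
  have hD0 : 0 < Dδ := lt_of_lt_of_le (by positivity) hD
  set N := (Fintype.card (Site 3 L) : ℝ) with hNdef
  set q : ℝ := min (36 * Dδ ^ 2) (N ^ 2 / (16 * Fintype.card (Edge 3 L))) with hqdef
  refine ⟨q, lt_min (by positivity) (by positivity), ?_⟩
  have hs2' : (0 : ℝ) < 1 / 2 - s := by linarith
  have hc : (0 : ℝ) < 1 / (60 * L) := by positivity
  have hδt : Tendsto (fun β : ℝ => Dδ * powScale s β) atTop (𝓝 0) := by simpa using (tendsto_powScale hs).const_mul Dδ
  filter_upwards [eventually_schedule_facts (L := L) hs hs2, eventually_ge_atTop (Real.exp 14), eventually_logpow4_le_mul_powScale hs2,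
    (tendsto_powScale_mul_btLog_pow hs2' 1).eventually (eventually_le_nhds (show (0 : ℝ) < Dδ / 9 by positivity)),
    (tendsto_powScale_mul_btLog_pow (show (0 : ℝ) < 1 / 2 by norm_num) 2).eventually (eventually_le_nhds hc),
    (tendsto_powScale_mul_btLog_pow (show (0 : ℝ) < 1 / 2 by norm_num) 1).eventually (eventually_le_nhds hc),
    hδt.eventually (eventually_lt_nhds (show (0 : ℝ) < 1 / (4000 * L) by positivity))] with β hf hβ14 hlog hsmall hxl2 hxl1 hδs
  obtain ⟨hβ1, hℓeq, -, -, hεx, -, -, -, -, hεs, -⟩ := hf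
  rw [pow_one] at hsmall hxl1
  have hℓ14 : 14 ≤ Real.log β := by rw [← Real.log_exp 14]; exact Real.log_le_log (Real.exp_pos _) hβ14
  rw [← hℓeq] at hℓ14 hlog ⊢
  have hεeq : btEps β = (powScale 1 β) := rfl
  rw [hεeq] at hεx hεs
  set x := powScale (1 / 2) β with hxdef
  set δ := Dδ * powScale s β with hδdef
  set ℓ := btLog β with hℓdef
  set ε := (powScale 1 β) with hεdef
  set r := (min (1 / 40) (powScale (1 / 2) β * btLog β)) with hrdef
  have hβ0 : 0 < β := by linarith
  have hx0 : 0 < x := powScale_pos _ _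
  have hx1 : x ≤ 1 := powScale_le_one (by norm_num) β
  have hℓ0 : 0 ≤ ℓ := by linarith
  have hℓ1 : 1 ≤ ℓ := by linarith
  have hδ0 : 0 ≤ δ := by rw [hδdef]; exact mul_nonneg hD0.le (powScale_pos _ _).le
  have hε0 : 0 ≤ ε := (powScale_pos _ _).le
  have hβx : β * x ^ 2 = 1 := mul_powScale_half_sq hβ1
  have h2 : Real.sqrt 2 ≤ 3 / 2 := by rw [Real.sqrt_le_left (by norm_num)]; norm_num
  have hs20 : 0 ≤ Real.sqrt 2 := Real.sqrt_nonneg _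
  have hxl0 : 0 ≤ x * ℓ := by positivity
  have h60 : (1 : ℝ) / (60 * L) ≤ 1 := by rw [div_le_one (by positivity)]; linarith
  have hxl1' : x * ℓ ≤ 1 := hxl1.trans h60
  have hxl21 : x * ℓ ^ 2 ≤ 1 := hxl2.trans h60
  have hxl20 : 0 ≤ x * ℓ ^ 2 / 2 := by positivity
  have hr0 : 0 ≤ r := le_min (by norm_num) hxl0
  have hrx : r ≤ x * ℓ := min_le_right _ _
  have e2r : Real.sqrt 2 * r ≤ 3 / 2 * (x * ℓ) := mul_le_mul h2 hrx hr0 (by norm_num)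
  have hLδ : (L : ℝ) * δ < 1 / 4000 := by
    have := mul_lt_mul_of_pos_left hδs hL0; rwa [show (L : ℝ) * (1 / (4000 * L)) = 1 / 4000 by field_simp] at this
  have hδhalf : δ ≤ 1 / 2 := by nlinarith
  -- `9xℓ ≤ δ`
  have hx9 : 9 * (x * ℓ) ≤ δ := by
    have e : x * ℓ = powScale (1 / 2 - s) β * ℓ * powScale s β := by
      rw [hxdef, powScale_eq hβ1, powScale_eq hβ1, powScale_eq hβ1]
      rw [show -(1 / 2 : ℝ) = -(1 / 2 - s) + -s by ring, Real.rpow_add hβ0]; ring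
    rw [e, hδdef]
    have hp := powScale_pos s β
    calc 9 * (powScale (1 / 2 - s) β * ℓ * powScale s β) = (9 * (powScale (1 / 2 - s) β * ℓ)) * powScale s β := by ring
      _ ≤ Dδ * powScale s β := mul_le_mul_of_nonneg_right (by linarith) hp.le
  -- the near-pair branches (`m = xℓ²/2`)
  have hA : x * ℓ ^ 2 / 2 ≤ (5 * (powScale (1 / 2) β * btLog β ^ 2)) / 2 - 2 * (Real.sqrt 2 * r + δ) * ε - (2 * Real.sqrt 2 * r + x * ℓ ^ 2) := by
    have e1 : 2 * (Real.sqrt 2 * r + δ) * ε ≤ 4 * (x * ℓ) := by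
      have h3 : Real.sqrt 2 * r + δ ≤ 3 / 2 * (x * ℓ) + 1 / 2 := by linarith
      have hεxl : ε ≤ x * ℓ := hεx.trans (le_mul_of_one_le_right hx0.le hℓ1)
      have h4 : 2 * (Real.sqrt 2 * r + δ) * ε ≤ 2 * (3 / 2 * (x * ℓ) + 1 / 2) * (x * ℓ) := mul_le_mul (by linarith) hεxl hε0 (by positivity)
      have h5 : (x * ℓ) * (x * ℓ) ≤ 1 * (x * ℓ) := mul_le_mul_of_nonneg_right hxl1' hxl0
      have h6 : 2 * (3 / 2 * (x * ℓ) + 1 / 2) * (x * ℓ) = 3 * ((x * ℓ) * (x * ℓ)) + x * ℓ := by ring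
      linarith
    have e3 : x * ℓ * 14 ≤ x * ℓ * ℓ := mul_le_mul_of_nonneg_left hℓ14 hxl0
    have e4 : x * ℓ ^ 2 = x * ℓ * ℓ := by ring
    have e5 : (5 * (powScale (1 / 2) β * btLog β ^ 2)) = 5 * (x * ℓ ^ 2) := by rw [hxdef, hℓdef]
    rw [e5]
    linarith
  have hB : x * ℓ ^ 2 / 2 ≤ 1 / (3 * L) - 4 * (Real.sqrt 2 * r + δ) - (2 * Real.sqrt 2 * r + x * ℓ ^ 2) := by
    have hu4000 : (1 : ℝ) / 4000 = 1 / 3 * (3 / 4000) := by ring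
    have hu60 : (1 : ℝ) / (60 * L) = 1 / (3 * L) / 20 := by ring
    have hu0 : (0 : ℝ) < 1 / (3 * L) := by positivity
    have hLδ' : δ < 1 / (3 * L) * (3 / 4000) := by
      rw [show 1 / (3 * (L : ℝ)) * (3 / 4000) = 1 / 4000 / L by field_simp]
      rw [lt_div_iff₀ hL0]; linarith
    rw [hu60] at hxl2 hxl1
    linarith
  -- the far-pair branches (`m₁ = 6δ`, `m₂ = N xℓ²/4`)
  have hm₁ : 6 * δ ≤ 13 * δ - 4 * (Real.sqrt 2 * r + δ) - (2 * Real.sqrt 2 * r + 2 * δ) := by linarith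
  have hm₂ : N * (x * ℓ ^ 2) / 4 ≤ N * (1 - 3 * L * (13 * δ)) * (x * ℓ ^ 2) - (2 * ε * N * δ + 2 * r ^ 2 + 2 * Real.sqrt 2 * N * (9 * L * (13 * δ) + ε) * r) := by
    have hxℓ20 : 0 ≤ x * ℓ ^ 2 := by positivity
    have hNx : 0 ≤ N * x := by positivity
    have h39 : 1 / 2 ≤ 1 - 3 * (L : ℝ) * (13 * δ) := by linarith
    have hsig : N * (1 / 2) * (x * ℓ ^ 2) ≤ N * (1 - 3 * L * (13 * δ)) * (x * ℓ ^ 2) := by gcongr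
    have j1 : 2 * ε * N * δ ≤ N * x := by
      have h := mul_le_mul hεx hδhalf hδ0 hx0.le
      have := mul_le_mul_of_nonneg_left h (by positivity : (0 : ℝ) ≤ 2 * N)
      have e : 2 * N * (ε * δ) = 2 * ε * N * δ := by ring
      have e' : 2 * N * (x * (1 / 2)) = N * x := by ring
      linarith
    have j2 : 2 * r ^ 2 ≤ 2 * (N * x) := by
      have hq := pow_le_pow_left₀ hr0 hrx 2
      have h' : x ≤ N * x := le_mul_of_one_le_left hx0.le hN1
      have h6 : (x * ℓ ^ 2) * x ≤ 1 * x := mul_le_mul_of_nonneg_right hxl21 hx0.le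
      calc 2 * r ^ 2 ≤ 2 * (x * ℓ) ^ 2 := by linarith
        _ = 2 * ((x * ℓ ^ 2) * x) := by ring
        _ ≤ 2 * (1 * x) := by linarith
        _ ≤ 2 * (N * x) := by linarith
    have j3 : 2 * Real.sqrt 2 * N * (9 * L * (13 * δ) + ε) * r ≤ 3 * (31 / 1000) * (N * (x * ℓ)) := by
      have hεs' : ε ≤ 1 / 600 := hεs.le
      have hin : 9 * (L : ℝ) * (13 * δ) + ε ≤ 31 / 1000 := by linarith [hεs']
      have hin0 : 0 ≤ 9 * (L : ℝ) * (13 * δ) + ε := by positivity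
      have h22 : 2 * Real.sqrt 2 ≤ 3 := by linarith
      calc 2 * Real.sqrt 2 * N * (9 * L * (13 * δ) + ε) * r = 2 * Real.sqrt 2 * (9 * L * (13 * δ) + ε) * (N * r) := by ring
        _ ≤ 3 * (31 / 1000) * (N * (x * ℓ)) :=
            mul_le_mul (mul_le_mul h22 hin hin0 (by norm_num)) (mul_le_mul_of_nonneg_left hrx hN.le) (by positivity) (by norm_num)
    have hℓN : N * x * 14 ≤ N * x * ℓ := mul_le_mul_of_nonneg_left hℓ14 hNx
    have hℓN2 : N * (x * ℓ) * 14 ≤ N * (x * ℓ) * ℓ := mul_le_mul_of_nonneg_left hℓ14 (by positivity)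
    have e1 : N * x * ℓ = N * (x * ℓ) := by ring
    have e2 : N * (x * ℓ) * ℓ = N * (x * ℓ ^ 2) := by ring
    have e3 : N * (1 / 2) * (x * ℓ ^ 2) = N * (x * ℓ ^ 2) / 2 := by ring
    linarith only [hsig, j1, j2, j3, hℓN, hℓN2, e1, e2, e3, hNx]
  have hm₂0 : 0 ≤ N * (x * ℓ ^ 2) / 4 := by positivity
  refine ⟨?_, by linarith [hA], by linarith [hB], by linarith, by linarith [hm₁], by linarith [hm₂, hm₂0], ?_, ?_⟩
  · -- hLa
    have : 18 * (L : ℝ) * (Real.sqrt 2 * r + δ) ≤ 18 * L * (3 / 2 * (x * ℓ)) + 18 * (L * δ) := by nlinarith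
    have h2' : 18 * (L : ℝ) * (3 / 2 * (x * ℓ)) ≤ 18 * L * (3 / 2 * (1 / (60 * L))) := by gcongr
    have h3 : 18 * (L : ℝ) * (3 / 2 * (1 / (60 * L))) = 9 / 20 := by field_simp; ring
    linarith
  · -- `β·m_nt ≥ ℓ⁴/4`
    have hkey : (x * ℓ ^ 2 / 2) ^ 2 ≤ btMnt L δ (x * ℓ ^ 2) r (5 * (powScale (1 / 2) β * btLog β ^ 2)) ε := btMnt_ge_sq (L := L) hxl20 hA hB
    calc ℓ ^ 4 / 4 = β * (x * ℓ ^ 2 / 2) ^ 2 := by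
          have : β * (x * ℓ ^ 2 / 2) ^ 2 = ℓ ^ 4 / 4 * (β * x ^ 2) := by ring
          rw [this, hβx, mul_one]
      _ ≤ _ := mul_le_mul_of_nonneg_left hkey hβ0.le
  · -- `β·m_far ≥ qℓ⁴`
    have hfloor := btMfar_ge_min (L := L) (by positivity : (0 : ℝ) ≤ 6 * δ) hm₂0 hm₁ hm₂
    have hq1 : q * ℓ ^ 4 ≤ β * (6 * δ) ^ 2 := by
      have hp2 : powScale s β ^ 2 = powScale (2 * s) β := by
        rw [powScale_eq hβ1, powScale_eq hβ1, ← Real.rpow_mul_natCast hβ0.le]; congr 1; push_cast; ring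
      have e : β * (6 * δ) ^ 2 = 36 * Dδ ^ 2 * (β * powScale (2 * s) β) := by rw [hδdef, mul_pow, mul_pow, hp2]; ring
      rw [e]
      calc q * ℓ ^ 4 ≤ 36 * Dδ ^ 2 * ℓ ^ 4 := mul_le_mul_of_nonneg_right (min_le_left _ _) (by positivity)
        _ ≤ 36 * Dδ ^ 2 * (β * powScale (2 * s) β) := mul_le_mul_of_nonneg_left hlog (by positivity)
    have hq2 : q * ℓ ^ 4 ≤ β * ((N * (x * ℓ ^ 2) / 4) ^ 2 / Fintype.card (Edge 3 L)) := by
      have e : β * ((N * (x * ℓ ^ 2) / 4) ^ 2 / Fintype.card (Edge 3 L)) = N ^ 2 / (16 * Fintype.card (Edge 3 L)) * ℓ ^ 4 * (β * x ^ 2) := by ring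
      rw [e, hβx, mul_one]
      exact mul_le_mul_of_nonneg_right (min_le_right _ _) (by positivity)
    calc q * ℓ ^ 4 ≤ β * min ((6 * δ) ^ 2) ((N * (x * ℓ ^ 2) / 4) ^ 2 / Fintype.card (Edge 3 L)) := by
          rw [mul_min_of_nonneg _ _ hβ0.le]; exact le_min hq1 hq2
      _ ≤ _ := mul_le_mul_of_nonneg_left hfloor hβ0.le

end Summit.QuantumFields.YangMills.Theorems.FemtoTransferGap.TwoLattice.ConstTube

end
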